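import Mathlib
import Literature.MathematicalPhysics.QuantumFieldTheory.Balaban1983to89.B9Eq3166
import Literature.MathematicalPhysics.QuantumFieldTheory.Balaban1983to89.B9Eq3184

/-! # `Balaban1983to89.B9Eq3170` — B9 Sect. E p. 430, (3.167) ⇒ (3.170): the `B`- and `μ`-integrations
# at measure level (the joint δ-constraint space of (3.167) is a graph over the constraint space of (3.170))

CITATION HEADER.  Unit `b2b-balaban-b09` (gen 17, cell pub-balaban), PAPER SUB-CELL B09 =
T. Balaban, *Propagators for lattice gauge theories in a background field*, Commun. Math. Phys. **99** (1985) 389–434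
[`Balaban1985BackgroundPropagators`] (= B9).  Sect. E, p. 430 [PDF 42] (render
`1985-cmp99-background-propagators-p042-x2.png`, READ AS AN IMAGE by this seat — the Euclid text layer is unreliable),
verbatim:
*"The above transformations give the following equality
exp(½⟨g, C^{(k)}(Λ)g⟩) = Z^{−1}∫dB↾_Λ δ(Q₁B)δ_{Ax}(B) × exp[+⟨H₁D̃^{(2)}(B), J⟩ + ⟨B, g⟩]∫dμ↾_Λ δ(Q′μ)
  × ∫dA δ(QA + D̄μ − B)δ_R̃(R̃D*A) × exp[−½⟨A − DG′RD*A + DH′μ, (Δ + Δ^{(2)}) × (A − DG′RD*A + DH′μ)⟩]. (3.167)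
In this integral we change the order of B- and μ-integrations, and we perform the gauge transformation B → B + D̄μ.
This gives us the following μ-integral to calculate ∫dμ δ(Q′₁μ)δ_{Ax}(B + D̄μ)G(μ). (3.168) The δ-functions above
determine μ uniquely as a linear function of B. … We denote the linear function defined by the above formulas by
μ(B). The integral (3.168) is equal to G(μ(B)). Applying this result to the integral in (3.167) and calculating the
integral with respect to B we get
exp(½⟨g, C^{(k)}(Λ)g⟩) = Z^{−1}∫dA δ(Q̃A)δ_R̃(R̃D*A) × exp[+⟨H₁D̃^{(2)}(QA + D̄μ(QA)), J⟩ − ½⟨A − DG′RD*A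
  × DH′μ(QA), (Δ + Δ^{(2)})(A − DG′RD*A + DH′μ(QA))⟩ + ⟨QA + D̄μ(QA), g⟩]. (3.170)"*
Used with it, verbatim (renders `…-p041-x2.png`, `…-p030-x2.png`, READ AS IMAGES by this seat): p. 429 [PDF 41] L1–4
*"Let us recall that the operators above are defined by the sequence {Ω_j}, j = 0, 1, …, k. We form a new sequence
adding the set Ω_{k+1} = B^k(Λ). Let us denote operators constructed for this sequence by a wavy line, e.g. G̃₁, H̃₁, Q̃,
etc. If we perform the B-integration above, we get an A-integral with the δ-function δ(Q̃A)."*; p. 429 (3.161), the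
μ-factor as first printed: *"∫dμ↾_Λ δ(Q′₁μ)"*; p. 418 [PDF 30] *"(QD^{L^{−1}}λ)(c) = R̄_c(Q′λ)(c₊) − (Q′λ)(c₋) =
(D_ŪQ′λ)(c). (3.114) Iterating this identity we obtain finally Q_jDλ = D^{L^jη}_{Ū^j}Q′_jλ = D̄^jQ′_jλ, (3.115) … In
particular they imply that the average QA are invariant with respect to gauge transformations λ satisfying Q′λ = 0,
i.e. λ∈N(Q′)."*

PRINT-READING NOTES (this seat; INFO, not divergences of content): (a) (3.167) prints the μ-factor as `δ(Q′μ)` where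
(3.161) and (3.168) print `δ(Q′₁μ)` — the same one-step (transported) site averaging, which the derivation (3.169) again
writes as `(Q′μ)(y) = Σ_{x∈B(y)} L^{−d}R(V(Γ_{y,x}))μ(x)`; below it is ONE matrix `Qp1`.  (b) In (3.170), lines 3–4,
*"A − DG′RD*A × DH′μ(QA)"*: the `×` is the line-break sign of the display; the factor is `A − DG′RD*A + DH′μ(QA)`, as the
second factor of the same form prints.

THE POINT.  The passage (3.167) ⇒ (3.170) is pure finite-dimensional measure theory on δ-functions of LINEAR
constraints, and it is typed here AT MEASURE LEVEL, in this lineage's frame ([g13–g15] `B9Eq3166.subInt N f =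
√det(NᵀN)·∫f(Nz)dz` = the Lebesgue integral over the subspace `Ran N`, basis-independent by `B9Eq3166.subInt_basis`).
The variables of (3.167) are `B` (a field on the bonds of Λ, index type `c`), `μ` (a field on the sites of Λ, index `m`)
and `A` (the fine field, index `b`); its δ-functions impose, JOINTLY in `X = (B, μ, A)`, the linear constraints
  `Q₁B = 0` (δ(Q₁B)), `χB = 0` (δ_{Ax}(B): `χ` = restriction to the axial bonds ⋃Ax(y)), `Q′₁μ = 0` (δ(Q′₁μ)),
  `QA + D̄μ − B = 0` (δ(QA + D̄μ − B)), `LA = 0` (δ_R̃(R̃D*A): `L` = ANY matrix of the Landau constraint, e.g. `ÑᵀΔD*`).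
(3.170) imposes on `A` alone: `Q̃A = 0` (δ(Q̃A)), `LA = 0`.  THEOREM (`joint_iff`, both inclusions, kernel): under the
next-level intertwining (3.114)/(3.115) `Q₁D̄ = D̿Q′₁` (hypothesis `h115`), `Q̃ = Q₁Q` (p. 429 L2–4: the wavy sequence
averages one level further on Λ; hypothesis `hQt`) and the unique solvability of the constraints of (3.168) for every
datum (structure `MuSelector` — verbatim the hypotheses `hsol`/`huniq` of [g14's] `B9Eq3184.mu_Dbar_of_unique`; for the
paper's data it is KERNEL: existence `B9Eq3169Mu.AxialFrame.axial_mu`/`avg_mu`, uniqueness `….mu_unique`, Jacobian one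
`B9Eq3168Jac.eq_3168`), the joint constraint set of (3.167) IS THE GRAPH, over the constraint set of (3.170), of the
linear map `A ↦ (B, μ) = (QA + D̄μ(QA), μ(QA))`:
  `Joint(B, μ, A) ⟺ Reduced(A) ∧ μ = μ(QA) ∧ B = QA + D̄μ(QA)`.
This is exactly what the print's four moves compute: the order change and the *"gauge transformation B → B + D̄μ"* are
changes of coordinates on the joint solution space (under which `δ(Q₁B)` is invariant BECAUSE `Q₁D̄μ = D̿Q′₁μ = 0` on
`supp δ(Q′₁μ)` — `Q1_shift`, the next-level case of the last quoted sentence of p. 418), the μ-integration (3.168) is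
`μ = μ(B)` at `B = QA`, and *"calculating the integral with respect to B"* against `δ(QA + D̄μ − B)` is `B = QA + D̄μ(QA)`,
which turns the remaining `δ(Q₁B)` into `δ(Q₁QA) = δ(Q̃A)`.
MEASURE LEVEL (`eq_3170`): consequently, for EVERY integrand `Φ(B, μ, A)` and every basis matrix `P` of the joint
solution space, `∫_{(3.167)} Φ := subInt P Φ = κ · subInt P′ (A ↦ Φ(QA + D̄μ(QA), μ(QA), A)) =: κ · ∫_{(3.170)} Φ∘Γ`, with
`P′` any basis matrix of `{Q̃A = 0, LA = 0}` and `κ = κ(P′) > 0` a ratio of Gram determinants (`kappa`, `kappa_pos`)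
INDEPENDENT OF `Φ` — hence of `g` and `J`: it is one of the constants the print keeps in `Z`, and the NORMALISED generating
functions (each side divided by its value at `g = 0`, `J = 0`, which is how `Z^{−1}` in (3.155)/(3.170) is fixed) agree
literally (`eq_3170_normalised`).  With the integrand of (3.167), `Φ = F(B)·Ψ(A − DG′RD*A + DH′μ)`
(`F(B) = exp[⟨H₁D̃^{(2)}(B), J⟩ + ⟨B, g⟩]`, `Ψ = exp[−½⟨·, (Δ + Δ^{(2)})·⟩]`), the right-hand integrand is
`F(QA + D̄μ(QA))·Ψ(A − DG′RD*A + DH′μ(QA))` — the integrand of (3.170), whose configuration is [g14's] `B9Eq3184.cfg170`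
BY NAME (`integrand167_graph`, `eq_3170_print`), the input of (3.176)–(3.184) ⇒ (3.183) (`B9Eq3184.config_3183`).

WHY THE JOINT READING (this seat's gloss, not in print).  The inner A-integral of (3.167) taken alone,
`∫dA δ(QA + D̄μ − B)δ_R̃(R̃D*A)(…)`, is for generic `(B, μ)` an integral over an EMPTY affine set: the Landau condition for
the EXTENDED sequence uses up the gauge freedom `N(Q̃′) ⊋ N(Q′)`, under which `QA` is NOT invariant (it moves by
`D̄Q′λ`, (3.115)), so `{A : R̃D*A = 0}` does not surject onto the values of `QA` (the deficiency is `dim N(Q′₁)`, exactly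
the freedom carried by `μ`).  The printed iterated integral is therefore a distribution in `(B, μ)`, and the honest
finite-dimensional object is the Lebesgue measure of the JOINT solution space — which is what `subInt` over a basis of
`jointSet` is; the print's formal δ-calculus (Jacobian 1 for `B`, `|det 𝒥|^{−1} = 1` for `μ` by `B9Eq3168Jac`) computes the
same thing in the product-of-one-dimensional-δ normalisation, which differs from the induced-surface-measure
normalisation of `subInt` by Φ-independent Gram constants (as already for (3.160)/(3.166) in `B9Eq3166`).

WHAT THIS FILE CERTIFIES (kernel, zero sorry; real matrices over arbitrary finite index types — `b` fine bonds,
`c` Λ-bonds (where `B` lives), `m` Λ-sites (where `μ` lives), `c₁` next-level bonds (range of `Q₁`, `Q̃`), `m₁`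
next-level sites Λ′ (range of `Q′₁`), `ax` axial bonds, `r` Landau rows; 𝔤-valued fields = an extra finite index):
§1 [folklore] `IsBasisOf` (basis matrix of a set), `gram_det_pos_of_injective`, `exists_mul_of_range_subset` +
   `isUnit_det_of_mul_eq` (two basis matrices of one set differ by an invertible matrix), **`subInt_eq_of_isBasisOf`** —
   the subspace integral is a functional of the subspace (from `B9Eq3166.subInt_basis`).
§2 `Q1_shift` ((3.114)/(3.115) one level up kills the μ-dependence of `δ(Q₁(B + D̄μ))` on `supp δ(Q′₁μ)`); structures
   `Joint`, `Reduced`, `MuSelector`; `MuSelector.add`/`smul`/`exists_matrix` (*"μ uniquely as a linear function of B"*: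
   a unique selector IS linear, hence a matrix); `MuSelector.mu_Dbar` (the (3.169) rule, = `B9Eq3184.mu_Dbar_of_unique` BY
   NAME); `MuSelector.of_bijective` ((3.168): a bijective constraint map `μ ↦ (Q′₁μ, χD̄μ)` gives the selector —
   the hypothesis is NOT vacuous); **`joint_iff`**.
§3 the graph matrix `graph Q D̄ Mu : Matrix ((c ⊕ m) ⊕ b) b ℝ` (`B`-rows `Q + D̄·Mu·Q`, `μ`-rows `Mu·Q`, `A`-rows `1`),
   `graph_mulVec`, `graph_injective`, **`graph_isBasisOf`** (a basis `P′` of `reducedSet` gives the basis `graph·P′` of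
   `jointSet`).
§4 `kappa`, `kappa_pos`, `kappa_basis` (κ is coordinate-free too), `subInt_graph`, **`eq_3170`**, `eq_3170_normalised`.
§5 `integrand167`, `integrand167_graph`, **`eq_3170_print`** (the two displays with their integrands, `cfg170` by name).
WHAT IT DOES NOT CERTIFY (located): the instance "`Q`, `Q₁`, `Q′₁`, `D̄`, `χ` = the concrete block-averaging /
derivative / axial-restriction operators of B9 Sect. C on `Λ ⊂ T₁^{(k)}`" and with it `h115`, `hQt` and `MuSelector` for
that instance (the last is kernel in `B9Eq3169Mu`/`B9Eq3168Jac` over an abstract bond set; (3.115) is used as a printed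
identity, kernel for the torus toy only, `QeLIntertwining`); the identification of constants
`Z^{−1}` ((3.161): `(Z^{(k)}(Λ))^{−1}Z_k^{−1}|det(Δ↾_{N(Q̃′)})|·…`) — constants are Φ-independent and cancel in every normalised
generating function, which is all (3.155)/(3.170)/(3.185) assert; the components of `δ(Q̃A)` OUTSIDE Λ (where `Q̃ = Q`
and `B = 0`; one abstract lattice here — adjoin unit rows to `Q₁` to model them, as in `B9Eq3184`'s D-b09.50 (a)); the
Faddeev–Popov step (3.170) ⇒ (3.183) (*"the same as in (3.121)"*, by hand: C-adv4-55, G-adv4-33) and everything analytic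
(Thm 3.15 stays under G-B9-10).  RECORDS: GAPS C-B9-80; DIVERGENCE D-b09.58 (joint reading; surface-measure
normalisation; one abstract lattice; `L` abstract).  Elementary; [folklore] + the paper's operators BY SHAPE; no
Literature `def` is restated.  NOT summit progress; NOT continuum; NOT Clay. -/

namespace Literature.MathematicalPhysics.QuantumFieldTheory.Balaban1983to89.B9Eq3170

open Matrix MeasureTheory
open B9Eq3166 (subInt subInt_basis)

noncomputable section

/-! ## §1  Folklore: basis matrices of a subspace; the subspace integral is a functional of the subspace -/

section Folklore

variable {N τ : Type*} [Fintype N] [Fintype τ] [DecidableEq τ]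

/-- `P` is a BASIS MATRIX of the set `S ⊆ ℝᴺ`: `z ↦ Pz` is injective with range exactly `S` (so `S` is the subspace
`Ran P` and the columns of `P` are a basis of it). [folklore] -/
structure IsBasisOf (P : Matrix N τ ℝ) (S : Set (N → ℝ)) : Prop where
  inj : Function.Injective P.mulVec
  range_eq : Set.range P.mulVec = S

omit [Fintype N] [DecidableEq τ] in
/-- A basis matrix parametrises members of its set. [folklore] -/
theorem IsBasisOf.mem_iff {P : Matrix N τ ℝ} {S : Set (N → ℝ)} (h : IsBasisOf P S) (X : N → ℝ) :
    X ∈ S ↔ ∃ z, P *ᵥ z = X := by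
  rw [← h.range_eq]; rfl

/-- An injective real matrix has a POSITIVE Gram determinant `det(PᵀP) > 0` (Mathlib: `PᵀP` is positive definite).
[folklore] -/
theorem gram_det_pos_of_injective (P : Matrix N τ ℝ) (hP : Function.Injective P.mulVec) :
    0 < (Pᵀ * P).det := by
  have h := (Matrix.PosDef.conjTranspose_mul_self P hP).det_pos
  simpa only [conjTranspose_eq_transpose_of_trivial] using h

omit [Fintype N] in
/-- If `Ran P₁ ⊆ Ran P₂` then `P₁ = P₂·M` for some square `M` (columnwise choice). [folklore] -/
theorem exists_mul_of_range_subset (P₁ P₂ : Matrix N τ ℝ)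
    (h : Set.range P₁.mulVec ⊆ Set.range P₂.mulVec) : ∃ M : Matrix τ τ ℝ, P₁ = P₂ * M := by
  classical
  have hcol : ∀ j : τ, ∃ z : τ → ℝ, P₂ *ᵥ z = P₁ *ᵥ Pi.single j 1 := fun j => h ⟨Pi.single j 1, rfl⟩
  choose z hz using hcol
  refine ⟨Matrix.of fun i j => z j i, ?_⟩
  ext i j
  have h1 : (P₁ *ᵥ Pi.single j 1) i = P₁ i j := by
    simp [mulVec, dotProduct, Pi.single_apply]
  have h2 : (P₂ *ᵥ z j) i = (P₂ * Matrix.of fun i j => z j i) i j := by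
    simp [mulVec, dotProduct, mul_apply]
  rw [← h1, ← hz j, h2]

omit [Fintype N] in
/-- If `P₁ = P₂·M` with `P₁` injective then `M` is invertible. [folklore] -/
theorem isUnit_det_of_mul_eq {P₁ P₂ : Matrix N τ ℝ} {M : Matrix τ τ ℝ}
    (hP₁ : Function.Injective P₁.mulVec) (h : P₁ = P₂ * M) : IsUnit M.det := by
  have hM : Function.Injective M.mulVec := by
    intro v w hvw
    apply hP₁
    show P₁ *ᵥ v = P₁ *ᵥ w
    rw [h, ← mulVec_mulVec, ← mulVec_mulVec, hvw]
  rw [← Matrix.isUnit_iff_isUnit_det]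
  exact Matrix.mulVec_injective_iff_isUnit.mp hM

/-- **THE SUBSPACE INTEGRAL IS A FUNCTIONAL OF THE SUBSPACE**: two basis matrices of the same set give the same
`subInt` (Lebesgue measure of `Ran P` in the Euclidean structure of `ℝᴺ`; = `B9Eq3166.subInt_basis` after the change of
basis). [folklore] -/
theorem subInt_eq_of_isBasisOf {P₁ P₂ : Matrix N τ ℝ} {S : Set (N → ℝ)} (h₁ : IsBasisOf P₁ S)
    (h₂ : IsBasisOf P₂ S) (f : (N → ℝ) → ℝ) : subInt P₁ f = subInt P₂ f := by
  obtain ⟨M, hM⟩ := exists_mul_of_range_subset P₁ P₂ (by rw [h₁.range_eq, h₂.range_eq])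
  rw [hM]
  exact subInt_basis P₂ M (isUnit_det_of_mul_eq h₁.inj hM) f

end Folklore

/-! ## §2  The constraints of (3.167) and (3.170), pointwise -/

section Pointwise

variable {b c m c₁ m₁ ax r : Type*} [Fintype b] [Fintype c] [Fintype m] [Fintype m₁]

/-- (3.114)/(3.115) ONE LEVEL UP kills the `μ`-dependence of `δ(Q₁(B + D̄μ))` on the support of `δ(Q′₁μ)`:
`Q₁(B + D̄μ) = Q₁B + D̿Q′₁μ = Q₁B` when `Q′₁μ = 0` (*"the average QA are invariant with respect to gauge transformations λ
satisfying Q′λ = 0"*, p. 418, at the next level). [cite: Balaban1985BackgroundPropagators, (3.115) p.418] -/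
theorem Q1_shift (Q₁ : Matrix c₁ c ℝ) (Db : Matrix c m ℝ) (Dbb : Matrix c₁ m₁ ℝ) (Qp1 : Matrix m₁ m ℝ)
    (h115 : Q₁ * Db = Dbb * Qp1) (B : c → ℝ) {μ : m → ℝ} (hμ : Qp1 *ᵥ μ = 0) :
    Q₁ *ᵥ (B + Db *ᵥ μ) = Q₁ *ᵥ B := by
  rw [mulVec_add, mulVec_mulVec, h115, ← mulVec_mulVec, hμ, mulVec_zero, add_zero]

/-- **The δ-constraints of (3.167)**, jointly in `(B, μ, A)`: `δ(Q₁B)`, `δ_{Ax}(B)` (`χ` = restriction to the axial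
bonds), `δ(Q′₁μ)`, `δ(QA + D̄μ − B)`, `δ_R̃(R̃D*A)` (`L` = the Landau constraint matrix).
[cite: Balaban1985BackgroundPropagators, (3.167) p.430] -/
structure Joint (Q₁ : Matrix c₁ c ℝ) (χ : Matrix ax c ℝ) (Qp1 : Matrix m₁ m ℝ) (Q : Matrix c b ℝ)
    (Db : Matrix c m ℝ) (L : Matrix r b ℝ) (B : c → ℝ) (μ : m → ℝ) (A : b → ℝ) : Prop where
  avg : Q₁ *ᵥ B = 0
  axial : χ *ᵥ B = 0
  avg1 : Qp1 *ᵥ μ = 0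
  block : Q *ᵥ A + Db *ᵥ μ - B = 0
  landau : L *ᵥ A = 0

/-- **The δ-constraints of (3.170)**, in `A` alone: `δ(Q̃A)`, `δ_R̃(R̃D*A)`.
[cite: Balaban1985BackgroundPropagators, (3.170) p.430] -/
structure Reduced (Qt : Matrix c₁ b ℝ) (L : Matrix r b ℝ) (A : b → ℝ) : Prop where
  avg : Qt *ᵥ A = 0
  landau : L *ᵥ A = 0

/-- *"The δ-functions above determine μ uniquely as a linear function of B"*: `mu B₀` solves the constraints of (3.168),
`Q′₁μ = 0` and `χ(B₀ + D̄μ) = 0`, at every datum `B₀`, and they have at most one solution — verbatim the hypotheses of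
[g14's] `B9Eq3184.mu_Dbar_of_unique` (for the paper's data: `B9Eq3169Mu.AxialFrame.axial_mu`, `avg_mu`, `mu_unique`).
[cite: Balaban1985BackgroundPropagators, (3.168)-(3.169) p.430] -/
structure MuSelector (Qp1 : Matrix m₁ m ℝ) (χ : Matrix ax c ℝ) (Db : Matrix c m ℝ)
    (mu : (c → ℝ) → (m → ℝ)) : Prop where
  sol : ∀ B₀, Qp1 *ᵥ mu B₀ = 0 ∧ χ *ᵥ (B₀ + Db *ᵥ mu B₀) = 0
  uniq : ∀ B₀ (ν₁ ν₂ : m → ℝ), Qp1 *ᵥ ν₁ = 0 → χ *ᵥ (B₀ + Db *ᵥ ν₁) = 0 →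
    Qp1 *ᵥ ν₂ = 0 → χ *ᵥ (B₀ + Db *ᵥ ν₂) = 0 → ν₁ = ν₂

namespace MuSelector

variable {Qp1 : Matrix m₁ m ℝ} {χ : Matrix ax c ℝ} {Db : Matrix c m ℝ} {mu : (c → ℝ) → (m → ℝ)}

omit [Fintype m₁] in
/-- A unique selector is ADDITIVE. [cite: Balaban1985BackgroundPropagators, p.430 L17-18] -/
theorem add (h : MuSelector Qp1 χ Db mu) (B₁ B₂ : c → ℝ) : mu (B₁ + B₂) = mu B₁ + mu B₂ :=
  h.uniq (B₁ + B₂) _ _ (h.sol _).1 (h.sol _).2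
    (by rw [mulVec_add, (h.sol B₁).1, (h.sol B₂).1, add_zero])
    (by
      have e : B₁ + B₂ + Db *ᵥ (mu B₁ + mu B₂) = (B₁ + Db *ᵥ mu B₁) + (B₂ + Db *ᵥ mu B₂) := by
        rw [mulVec_add]; abel
      rw [e, mulVec_add, (h.sol B₁).2, (h.sol B₂).2, add_zero])

omit [Fintype m₁] in
/-- A unique selector is HOMOGENEOUS. [cite: Balaban1985BackgroundPropagators, p.430 L17-18] -/
theorem smul (h : MuSelector Qp1 χ Db mu) (a : ℝ) (B₀ : c → ℝ) : mu (a • B₀) = a • mu B₀ :=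
  h.uniq (a • B₀) _ _ (h.sol _).1 (h.sol _).2
    (by rw [mulVec_smul, (h.sol B₀).1, smul_zero])
    (by rw [mulVec_smul, ← smul_add, mulVec_smul, (h.sol B₀).2, smul_zero])

omit [Fintype m₁] in
/-- *"μ uniquely as a linear function of B"*: a unique selector is given by a MATRIX.
[cite: Balaban1985BackgroundPropagators, p.430 L17-18] -/
theorem exists_matrix [DecidableEq c] (h : MuSelector Qp1 χ Db mu) :
    ∃ Mu : Matrix m c ℝ, mu = Mu.mulVec := by
  let f : (c → ℝ) →ₗ[ℝ] (m → ℝ) :=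
    { toFun := mu, map_add' := h.add, map_smul' := h.smul }
  refine ⟨LinearMap.toMatrix' f, ?_⟩
  funext B₀
  rw [LinearMap.toMatrix'_mulVec]
  rfl

omit [Fintype m₁] in
/-- The (3.169) rule *"μ(D̄v) = −v if Q′₁v = 0"* for any unique selector — [g14's] `B9Eq3184.mu_Dbar_of_unique` BY NAME.
[cite: Balaban1985BackgroundPropagators, p.431 L-8] -/
theorem mu_Dbar (h : MuSelector Qp1 χ Db mu) (v : m → ℝ) (hv : Qp1 *ᵥ v = 0) : mu (Db *ᵥ v) = -v :=
  B9Eq3184.mu_Dbar_of_unique Qp1 Db χ mu h.sol h.uniq v hv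

omit [Fintype m₁] in
/-- **(3.168)**: if the constraint map `𝒥 : μ ↦ (Q′₁μ, χD̄μ)` of (3.168) is a linear BIJECTION (for the paper's data:
`|det 𝒥| = 1`, [g14's] `B9Eq3168Jac.abs_det_fullJac`; existence/uniqueness directly: [g12's] `B9Eq3169Mu`), then a
unique selector exists: `μ(B₀) = 𝒥⁻¹(0, −χB₀)`. [cite: Balaban1985BackgroundPropagators, (3.168)-(3.169) p.430] -/
theorem of_bijective (Qp1 : Matrix m₁ m ℝ) (χ : Matrix ax c ℝ) (Db : Matrix c m ℝ)
    (hJ : Function.Bijective fun μ : m → ℝ => (Qp1 *ᵥ μ, χ *ᵥ (Db *ᵥ μ))) :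
    ∃ mu : (c → ℝ) → (m → ℝ), MuSelector Qp1 χ Db mu := by
  choose inv hinv using hJ.2
  refine ⟨fun B₀ => inv (0, -(χ *ᵥ B₀)), ?_, ?_⟩
  · intro B₀
    have h := hinv (0, -(χ *ᵥ B₀))
    simp only [Prod.mk.injEq] at h
    refine ⟨h.1, ?_⟩
    rw [mulVec_add, h.2, add_neg_cancel]
  · intro B₀ ν₁ ν₂ h1 h2 h3 h4
    apply hJ.1
    show (Qp1 *ᵥ ν₁, χ *ᵥ (Db *ᵥ ν₁)) = (Qp1 *ᵥ ν₂, χ *ᵥ (Db *ᵥ ν₂))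
    rw [mulVec_add] at h2 h4
    rw [h1, h3, eq_neg_of_add_eq_zero_right h2, eq_neg_of_add_eq_zero_right h4]

end MuSelector

/-- **(3.167) ⇒ (3.170), pointwise**: the joint δ-constraints of (3.167) hold at `(B, μ, A)` iff `A` satisfies the
constraints of (3.170), `μ = μ(QA)` and `B = QA + D̄μ(QA)` — the print's *"gauge transformation B → B + D̄μ"*, the
μ-integration (3.168) at `B = QA`, and *"calculating the integral with respect to B"* (`δ(QA + D̄μ − B)`: `B = QA + D̄μ`;
then `δ(Q₁B) = δ(Q₁QA) = δ(Q̃A)` by `Q1_shift` and `Q̃ = Q₁Q`). [cite: Balaban1985BackgroundPropagators, (3.167)-(3.170) p.430] -/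
theorem joint_iff (Q₁ : Matrix c₁ c ℝ) (χ : Matrix ax c ℝ) (Qp1 : Matrix m₁ m ℝ) (Q : Matrix c b ℝ)
    (Db : Matrix c m ℝ) (L : Matrix r b ℝ) (Qt : Matrix c₁ b ℝ) (Dbb : Matrix c₁ m₁ ℝ)
    (h115 : Q₁ * Db = Dbb * Qp1) (hQt : Qt = Q₁ * Q) {mu : (c → ℝ) → (m → ℝ)} (hmu : MuSelector Qp1 χ Db mu)
    (B : c → ℝ) (μ : m → ℝ) (A : b → ℝ) :
    Joint Q₁ χ Qp1 Q Db L B μ A ↔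
      Reduced Qt L A ∧ μ = mu (Q *ᵥ A) ∧ B = Q *ᵥ A + Db *ᵥ mu (Q *ᵥ A) := by
  constructor
  · intro h
    have hB : B = Q *ᵥ A + Db *ᵥ μ := (sub_eq_zero.mp h.block).symm
    have hμ : μ = mu (Q *ᵥ A) :=
      hmu.uniq (Q *ᵥ A) μ (mu (Q *ᵥ A)) h.avg1 (by rw [← hB]; exact h.axial) (hmu.sol _).1 (hmu.sol _).2
    refine ⟨⟨?_, h.landau⟩, hμ, by rw [← hμ]; exact hB⟩
    have ha := h.avg
    rw [hB, Q1_shift Q₁ Db Dbb Qp1 h115 _ h.avg1, mulVec_mulVec, ← hQt] at ha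
    exact ha
  · rintro ⟨hR, hμ, hB⟩
    refine ⟨?_, ?_, ?_, ?_, hR.landau⟩
    · rw [hB, Q1_shift Q₁ Db Dbb Qp1 h115 _ (hmu.sol _).1, mulVec_mulVec, ← hQt]; exact hR.avg
    · rw [hB]; exact (hmu.sol _).2
    · rw [hμ]; exact (hmu.sol _).1
    · rw [hB, hμ, sub_self]

end Pointwise

/-! ## §3  The graph matrix: the joint solution space of (3.167) is a graph over that of (3.170) -/

section Graph

variable {b c m c₁ m₁ ax r : Type*} [Fintype b] [Fintype c] [Fintype m] [Fintype m₁] [DecidableEq b]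

/-- The `B`-component of a joint variable `X = (B, μ, A) : (c ⊕ m) ⊕ b → ℝ` of (3.167). [folklore] -/
def bPart (X : (c ⊕ m) ⊕ b → ℝ) : c → ℝ := fun i => X (Sum.inl (Sum.inl i))

/-- The `μ`-component of a joint variable `X = (B, μ, A)` of (3.167). [folklore] -/
def muPart (X : (c ⊕ m) ⊕ b → ℝ) : m → ℝ := fun x => X (Sum.inl (Sum.inr x))

/-- The `A`-component of a joint variable `X = (B, μ, A)` of (3.167). [folklore] -/
def aPart (X : (c ⊕ m) ⊕ b → ℝ) : b → ℝ := fun j => X (Sum.inr j)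

omit [Fintype b] [Fintype c] [Fintype m] [DecidableEq b] in
/-- A joint variable is the concatenation of its three components. [folklore] -/
theorem elim_parts (X : (c ⊕ m) ⊕ b → ℝ) : Sum.elim (Sum.elim (bPart X) (muPart X)) (aPart X) = X := by
  ext ((i | x) | j) <;> rfl

/-- **The graph map of (3.167) ⇒ (3.170)** as a matrix: `A ↦ (QA + D̄·Mu·QA, Mu·QA, A)`
(`Mu` = the matrix of `μ(·)`). [cite: Balaban1985BackgroundPropagators, (3.170) p.430] -/
def graph (Q : Matrix c b ℝ) (Db : Matrix c m ℝ) (Mu : Matrix m c ℝ) : Matrix ((c ⊕ m) ⊕ b) b ℝ :=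
  fromRows (fromRows (Q + Db * Mu * Q) (Mu * Q)) 1

variable (Q : Matrix c b ℝ) (Db : Matrix c m ℝ) (Mu : Matrix m c ℝ)

/-- The graph map on a vector: `graph·A = (QA + D̄·Mu·QA, Mu·QA, A)`.
[cite: Balaban1985BackgroundPropagators, (3.170) p.430] -/
theorem graph_mulVec (A : b → ℝ) :
    graph Q Db Mu *ᵥ A = Sum.elim (Sum.elim (Q *ᵥ A + Db *ᵥ (Mu *ᵥ (Q *ᵥ A))) (Mu *ᵥ (Q *ᵥ A))) A := by
  simp only [graph, fromRows_mulVec, add_mulVec, one_mulVec, ← mulVec_mulVec]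

/-- `B`-component of the graph map: `B = QA + D̄μ(QA)`. [cite: Balaban1985BackgroundPropagators, (3.170) p.430] -/
theorem bPart_graph (A : b → ℝ) : bPart (graph Q Db Mu *ᵥ A) = Q *ᵥ A + Db *ᵥ (Mu *ᵥ (Q *ᵥ A)) := by
  rw [graph_mulVec]; rfl

/-- `μ`-component of the graph map: `μ = μ(QA)`. [cite: Balaban1985BackgroundPropagators, (3.170) p.430] -/
theorem muPart_graph (A : b → ℝ) : muPart (graph Q Db Mu *ᵥ A) = Mu *ᵥ (Q *ᵥ A) := by
  rw [graph_mulVec]; rfl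

/-- `A`-component of the graph map: `A`. [cite: Balaban1985BackgroundPropagators, (3.170) p.430] -/
theorem aPart_graph (A : b → ℝ) : aPart (graph Q Db Mu *ᵥ A) = A := by
  rw [graph_mulVec]; rfl

/-- The graph map is injective (its `A`-rows are the identity). [folklore] -/
theorem graph_injective : Function.Injective (graph Q Db Mu).mulVec := by
  intro A A' h
  have h' := congrArg aPart h
  rwa [aPart_graph, aPart_graph] at h'

/-- `graph·P′` is injective when `P′` is. [folklore] -/
theorem graph_mul_injective {τ : Type*} [Fintype τ] {P' : Matrix b τ ℝ} (hP' : Function.Injective P'.mulVec) :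
    Function.Injective (graph Q Db Mu * P').mulVec := by
  intro z w h
  apply hP'
  apply graph_injective Q Db Mu
  show graph Q Db Mu *ᵥ (P' *ᵥ z) = graph Q Db Mu *ᵥ (P' *ᵥ w)
  rw [mulVec_mulVec, mulVec_mulVec]
  exact h

/-- The joint solution set of (3.167) in `X = (B, μ, A)`. [cite: Balaban1985BackgroundPropagators, (3.167) p.430] -/
def jointSet (Q₁ : Matrix c₁ c ℝ) (χ : Matrix ax c ℝ) (Qp1 : Matrix m₁ m ℝ) (Q : Matrix c b ℝ)
    (Db : Matrix c m ℝ) (L : Matrix r b ℝ) : Set ((c ⊕ m) ⊕ b → ℝ) :=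
  {X | Joint Q₁ χ Qp1 Q Db L (bPart X) (muPart X) (aPart X)}

/-- The solution set of (3.170). [cite: Balaban1985BackgroundPropagators, (3.170) p.430] -/
def reducedSet (Qt : Matrix c₁ b ℝ) (L : Matrix r b ℝ) : Set (b → ℝ) := {A | Reduced Qt L A}

/-- **A basis `P′` of the (3.170) solution space gives the basis `graph·P′` of the (3.167) solution space.**
[cite: Balaban1985BackgroundPropagators, (3.167)-(3.170) p.430] -/
theorem graph_isBasisOf (Q₁ : Matrix c₁ c ℝ) (χ : Matrix ax c ℝ) (Qp1 : Matrix m₁ m ℝ) (L : Matrix r b ℝ)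
    (Qt : Matrix c₁ b ℝ) (Dbb : Matrix c₁ m₁ ℝ) (h115 : Q₁ * Db = Dbb * Qp1) (hQt : Qt = Q₁ * Q)
    (hmu : MuSelector Qp1 χ Db Mu.mulVec) {τ : Type*} [Fintype τ] {P' : Matrix b τ ℝ}
    (hP' : IsBasisOf P' (reducedSet Qt L)) :
    IsBasisOf (graph Q Db Mu * P') (jointSet Q₁ χ Qp1 Q Db L) := by
  refine ⟨graph_mul_injective Q Db Mu hP'.inj, ?_⟩
  ext X
  constructor
  · rintro ⟨z, rfl⟩
    have hA : P' *ᵥ z ∈ reducedSet Qt L := (hP'.mem_iff _).mpr ⟨z, rfl⟩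
    show Joint Q₁ χ Qp1 Q Db L (bPart ((graph Q Db Mu * P') *ᵥ z)) (muPart ((graph Q Db Mu * P') *ᵥ z))
      (aPart ((graph Q Db Mu * P') *ᵥ z))
    rw [← mulVec_mulVec, bPart_graph, muPart_graph, aPart_graph]
    exact (joint_iff Q₁ χ Qp1 Q Db L Qt Dbb h115 hQt hmu _ _ _).mpr ⟨hA, rfl, rfl⟩
  · intro hX
    obtain ⟨hR, hμ, hB⟩ := (joint_iff Q₁ χ Qp1 Q Db L Qt Dbb h115 hQt hmu _ _ _).mp hX
    obtain ⟨z, hz⟩ := (hP'.mem_iff _).mp (show aPart X ∈ reducedSet Qt L from hR)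
    refine ⟨z, ?_⟩
    show (graph Q Db Mu * P') *ᵥ z = X
    rw [← mulVec_mulVec, hz, graph_mulVec]
    rw [← hB, ← hμ, elim_parts]

end Graph

/-! ## §4  Measure level: (3.167) = κ · (3.170) for every integrand -/

section Measure

variable {b c m c₁ m₁ ax r τ : Type*} [Fintype b] [Fintype c] [Fintype m] [Fintype m₁] [DecidableEq b]
  [Fintype τ] [DecidableEq τ]

variable (Q : Matrix c b ℝ) (Db : Matrix c m ℝ) (Mu : Matrix m c ℝ)

/-- **The constant of (3.167) = κ·(3.170)**: the ratio of the Gram determinants of the graph basis `graph·P′` and of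
`P′` — a number depending on the operators and the coordinates `P′` only, NOT on the integrand (absorbed in `Z` in
print). [cite: Balaban1985BackgroundPropagators, (3.170) p.430] -/
def kappa (P' : Matrix b τ ℝ) : ℝ :=
  Real.sqrt (((graph Q Db Mu * P')ᵀ * (graph Q Db Mu * P')).det) / Real.sqrt ((P'ᵀ * P').det)

/-- `κ > 0`. [cite: Balaban1985BackgroundPropagators, (3.170) p.430] -/
theorem kappa_pos {P' : Matrix b τ ℝ} (hP' : Function.Injective P'.mulVec) : 0 < kappa Q Db Mu P' :=
  div_pos (Real.sqrt_pos.mpr (gram_det_pos_of_injective _ (graph_mul_injective Q Db Mu hP')))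
    (Real.sqrt_pos.mpr (gram_det_pos_of_injective _ hP'))

/-- `κ` does not depend on the coordinates either: `κ(P′M) = κ(P′)` for invertible `M`. [folklore] -/
theorem kappa_basis (P' : Matrix b τ ℝ) (M : Matrix τ τ ℝ) (hM : IsUnit M.det) :
    kappa Q Db Mu (P' * M) = kappa Q Db Mu P' := by
  unfold kappa
  have hsq : ∀ Nm : Matrix ((c ⊕ m) ⊕ b) τ ℝ,
      Real.sqrt (((Nm * M)ᵀ * (Nm * M)).det) = |M.det| * Real.sqrt ((Nmᵀ * Nm).det) := by
    intro Nm
    have hgram : (Nm * M)ᵀ * (Nm * M) = Mᵀ * (Nmᵀ * Nm) * M := by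
      rw [Matrix.transpose_mul Nm M]; simp only [Matrix.mul_assoc]
    rw [hgram, det_mul, det_mul, det_transpose, show M.det * (Nmᵀ * Nm).det * M.det =
      M.det ^ 2 * (Nmᵀ * Nm).det by ring, Real.sqrt_mul (sq_nonneg _), Real.sqrt_sq_eq_abs]
  have hsq' : Real.sqrt (((P' * M)ᵀ * (P' * M)).det) = |M.det| * Real.sqrt ((P'ᵀ * P').det) := by
    have hgram : (P' * M)ᵀ * (P' * M) = Mᵀ * (P'ᵀ * P') * M := by
      rw [Matrix.transpose_mul P' M]; simp only [Matrix.mul_assoc]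
    rw [hgram, det_mul, det_mul, det_transpose, show M.det * (P'ᵀ * P').det * M.det =
      M.det ^ 2 * (P'ᵀ * P').det by ring, Real.sqrt_mul (sq_nonneg _), Real.sqrt_sq_eq_abs]
  rw [show graph Q Db Mu * (P' * M) = graph Q Db Mu * P' * M from (Matrix.mul_assoc _ _ _).symm, hsq, hsq']
  have hM0 : |M.det| ≠ 0 := abs_ne_zero.mpr hM.ne_zero
  rw [mul_div_mul_left _ _ hM0]

/-- The subspace integral over the graph basis `graph·P′` is `κ` times the `P′`-integral of the integrand composed with
the graph map. [folklore] -/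
theorem subInt_graph (P' : Matrix b τ ℝ) (hP' : Function.Injective P'.mulVec)
    (Φ : ((c ⊕ m) ⊕ b → ℝ) → ℝ) :
    subInt (graph Q Db Mu * P') Φ = kappa Q Db Mu P' * subInt P' (fun A => Φ (graph Q Db Mu *ᵥ A)) := by
  unfold subInt kappa
  have h0 : Real.sqrt ((P'ᵀ * P').det) ≠ 0 :=
    (Real.sqrt_pos.mpr (gram_det_pos_of_injective P' hP')).ne'
  have hI : (∫ z : τ → ℝ, Φ ((graph Q Db Mu * P') *ᵥ z)) =
      ∫ z : τ → ℝ, Φ (graph Q Db Mu *ᵥ (P' *ᵥ z)) := by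
    simp_rw [mulVec_mulVec]
  rw [hI]
  field_simp

/-- **(3.167) = κ · (3.170) AT MEASURE LEVEL, for every integrand.**  For ANY basis matrix `P` of the joint solution
space of the δ-constraints of (3.167) and any basis matrix `P′` of the solution space of those of (3.170) (same column
type: the two spaces are isomorphic by the graph map),
`∫_{(3.167)} Φ = subInt P Φ = κ(P′) · subInt P′ (A ↦ Φ(QA + D̄μ(QA), μ(QA), A)) = κ · ∫_{(3.170)} Φ∘graph`,
`κ > 0` independent of `Φ`. [cite: Balaban1985BackgroundPropagators, (3.167)-(3.170) p.430] -/
theorem eq_3170 (Q₁ : Matrix c₁ c ℝ) (χ : Matrix ax c ℝ) (Qp1 : Matrix m₁ m ℝ) (L : Matrix r b ℝ)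
    (Qt : Matrix c₁ b ℝ) (Dbb : Matrix c₁ m₁ ℝ) (h115 : Q₁ * Db = Dbb * Qp1) (hQt : Qt = Q₁ * Q)
    (hmu : MuSelector Qp1 χ Db Mu.mulVec) {P : Matrix ((c ⊕ m) ⊕ b) τ ℝ}
    (hP : IsBasisOf P (jointSet Q₁ χ Qp1 Q Db L)) {P' : Matrix b τ ℝ} (hP' : IsBasisOf P' (reducedSet Qt L))
    (Φ : ((c ⊕ m) ⊕ b → ℝ) → ℝ) :
    subInt P Φ = kappa Q Db Mu P' * subInt P' (fun A => Φ (graph Q Db Mu *ᵥ A)) := by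
  rw [subInt_eq_of_isBasisOf hP (graph_isBasisOf Q Db Mu Q₁ χ Qp1 L Qt Dbb h115 hQt hmu hP') Φ]
  exact subInt_graph Q Db Mu P' hP'.inj Φ

/-- **The normalised generating functions agree literally**: dividing each side by its value at a reference integrand
`Φ₀` (in print: `g = 0`, `J = 0`, which fixes `Z^{−1}`) removes `κ`.
[cite: Balaban1985BackgroundPropagators, (3.155) p.427; (3.170) p.430] -/
theorem eq_3170_normalised (Q₁ : Matrix c₁ c ℝ) (χ : Matrix ax c ℝ) (Qp1 : Matrix m₁ m ℝ) (L : Matrix r b ℝ)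
    (Qt : Matrix c₁ b ℝ) (Dbb : Matrix c₁ m₁ ℝ) (h115 : Q₁ * Db = Dbb * Qp1) (hQt : Qt = Q₁ * Q)
    (hmu : MuSelector Qp1 χ Db Mu.mulVec) {P : Matrix ((c ⊕ m) ⊕ b) τ ℝ}
    (hP : IsBasisOf P (jointSet Q₁ χ Qp1 Q Db L)) {P' : Matrix b τ ℝ} (hP' : IsBasisOf P' (reducedSet Qt L))
    (Φ Φ₀ : ((c ⊕ m) ⊕ b → ℝ) → ℝ) :
    subInt P Φ / subInt P Φ₀ =
      subInt P' (fun A => Φ (graph Q Db Mu *ᵥ A)) / subInt P' (fun A => Φ₀ (graph Q Db Mu *ᵥ A)) := by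
  rw [eq_3170 Q Db Mu Q₁ χ Qp1 L Qt Dbb h115 hQt hmu hP hP' Φ,
    eq_3170 Q Db Mu Q₁ χ Qp1 L Qt Dbb h115 hQt hmu hP hP' Φ₀,
    mul_div_mul_left _ _ (kappa_pos Q Db Mu hP'.inj).ne']

end Measure

/-! ## §5  The printed integrands: (3.167) and (3.170) as displayed -/

section Print

variable {n b c m c₁ m₁ ax r τ : Type*} [Fintype n] [Fintype b] [Fintype c] [Fintype m] [Fintype m₁]
  [DecidableEq b] [Fintype τ] [DecidableEq τ]

/-- **The integrand of (3.167)**: `F(B)·Ψ(A − DG′RD*A + DH′μ)` with `F(B) = exp[⟨H₁D̃^{(2)}(B), J⟩ + ⟨B, g⟩]` and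
`Ψ = exp[−½⟨·, (Δ + Δ^{(2)})·⟩]` (any `F`, `Ψ`). [cite: Balaban1985BackgroundPropagators, (3.167) p.430] -/
def integrand167 (F : (c → ℝ) → ℝ) (Ψ : (b → ℝ) → ℝ) (D : Matrix b n ℝ) (Gp Rp : Matrix n n ℝ)
    (Hp : Matrix n m ℝ) (X : (c ⊕ m) ⊕ b → ℝ) : ℝ :=
  F (bPart X) * Ψ (aPart X - D *ᵥ (Gp *ᵥ (Rp *ᵥ (Dᵀ *ᵥ aPart X))) + D *ᵥ (Hp *ᵥ muPart X))

/-- Composed with the graph map, the integrand of (3.167) IS the integrand of (3.170):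
`F(QA + D̄μ(QA))·Ψ(A − DG′RD*A + DH′μ(QA))`, the configuration being [g14's] `B9Eq3184.cfg170` BY NAME.
[cite: Balaban1985BackgroundPropagators, (3.170) p.430] -/
theorem integrand167_graph (F : (c → ℝ) → ℝ) (Ψ : (b → ℝ) → ℝ) (D : Matrix b n ℝ) (Gp Rp : Matrix n n ℝ)
    (Hp : Matrix n m ℝ) (Q : Matrix c b ℝ) (Db : Matrix c m ℝ) (Mu : Matrix m c ℝ) (A : b → ℝ) :
    integrand167 F Ψ D Gp Rp Hp (graph Q Db Mu *ᵥ A) =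
      F (Q *ᵥ A + Db *ᵥ (Mu *ᵥ (Q *ᵥ A))) * Ψ (B9Eq3184.cfg170 D Gp Rp Q Hp Mu.mulVecLin A) := by
  simp only [integrand167, bPart_graph, muPart_graph, aPart_graph, B9Eq3184.cfg170, Matrix.mulVecLin_apply]

/-- **(3.167) ⇒ (3.170) as printed**: `∫dB δ(Q₁B)δ_{Ax}(B)F(B)∫dμ δ(Q′₁μ)∫dA δ(QA + D̄μ − B)δ_R̃(R̃D*A)Ψ(A − DG′RD*A + DH′μ)`
(read as the Lebesgue integral of `F(B)Ψ(…)` over the joint solution space, basis `P`) `= κ · ∫dA δ(Q̃A)δ_R̃(R̃D*A)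
F(QA + D̄μ(QA))Ψ(A − DG′RD*A + DH′μ(QA))` (basis `P′`), `κ > 0` independent of `F`, `Ψ` (so of `g`, `J`).
[cite: Balaban1985BackgroundPropagators, (3.167)-(3.170) p.430] -/
theorem eq_3170_print (F : (c → ℝ) → ℝ) (Ψ : (b → ℝ) → ℝ) (D : Matrix b n ℝ) (Gp Rp : Matrix n n ℝ)
    (Hp : Matrix n m ℝ) (Q : Matrix c b ℝ) (Db : Matrix c m ℝ) (Mu : Matrix m c ℝ) (Q₁ : Matrix c₁ c ℝ)
    (χ : Matrix ax c ℝ) (Qp1 : Matrix m₁ m ℝ) (L : Matrix r b ℝ) (Qt : Matrix c₁ b ℝ) (Dbb : Matrix c₁ m₁ ℝ)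
    (h115 : Q₁ * Db = Dbb * Qp1) (hQt : Qt = Q₁ * Q) (hmu : MuSelector Qp1 χ Db Mu.mulVec)
    {P : Matrix ((c ⊕ m) ⊕ b) τ ℝ} (hP : IsBasisOf P (jointSet Q₁ χ Qp1 Q Db L)) {P' : Matrix b τ ℝ}
    (hP' : IsBasisOf P' (reducedSet Qt L)) :
    subInt P (integrand167 F Ψ D Gp Rp Hp) =
      kappa Q Db Mu P' *
        subInt P' (fun A => F (Q *ᵥ A + Db *ᵥ (Mu *ᵥ (Q *ᵥ A))) *
          Ψ (B9Eq3184.cfg170 D Gp Rp Q Hp Mu.mulVecLin A)) := by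
  rw [eq_3170 Q Db Mu Q₁ χ Qp1 L Qt Dbb h115 hQt hmu hP hP' (integrand167 F Ψ D Gp Rp Hp)]
  simp only [integrand167_graph]

end Print

end

end Literature.MathematicalPhysics.QuantumFieldTheory.Balaban1983to89.B9Eq3170
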